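import Summits.KontsevichZagierPeriods.KontsevichZagierPeriods.Theses.SymplecticScissors
import Literature.NumberTheory.Transcendental.CurvePeriodsPathConnectedProofs
import Literature.NumberTheory.Transcendental.KZSemialgebraicComplex
import Literature.NumberTheory.Transcendental.KZPeriodsProofs
import Literature.NumberTheory.Transcendental.SemialgebraicMapsProofs
import Literature.NumberTheory.Transcendental.SemialgebraicLineDeriv
import Summits.KontsevichZagierPeriods.KontsevichZagierPeriods.Theorems.SymplecticScissorsRealOnePeriodRelationsStubHomotopyInvarianceAux

/-!
# `RealOnePeriodRelations` (stmt-KontsevichZagierPeriods-10042, route SymplecticScissors) — line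
`nash-retraction-thin-strip`, stub `stub_saChart`

SEMIALGEBRAIC GRAPH CHARTS of an embedded smooth affine curve `Z = {F₁ = ⋯ = Fₘ = 0} ⊂ ℂⁿ` over
`ℚ̄` (`CurveData.IsSmoothAffineCurve`). The tree's local structure theorem
`CurveData.IsSmoothAffineCurve.exists_localChart` makes `Z(ℂ)` near any point `z₀` the graph
`ψ(B)` of a holomorphic map over one coordinate `i₀`, `B = B(z₀ i₀, ε₀)`, with respect to an open
`Ω₀ ∋ z₀`. Here the chart is RE-CENTRED at a Gaussian-rational point `c` close to `z₀ i₀` (the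
point `z₀` itself may be transcendental) and it is shown that on a closed disc `closedBall c ρ` of
rational radius the realified chart `ℝ² ⊃ closedBall c ρ → ℝ²ⁿ` is a `ℚ`-SEMIALGEBRAIC MAP: for an
open box `D ∋ z₀` with rational corners inside `Ω₀` and `ρ` so small that `ψ(closedBall c ρ) ⊆ D`,
the value `ψ(w)` is the unique point `z ∈ Z(ℂ) ∩ D` with `z i₀ = w`, so the graph of `ψ` over the
disc is `{(w, z) | w ∈ closedBall c ρ, z ∈ Z(ℂ), z ∈ D, z i₀ = w}`; the realification of `Z(ℂ)` is
`ℚ`-semialgebraic because the equations have algebraic coefficients (real and imaginary parts of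
`Fⱼ(x + iy)` are `ℚ`-semialgebraic functions of `(x, y) ∈ ℝ²ⁿ`, `KZSemialgebraicComplex`), and the
disc, the box and the equation `z i₀ = w` are polynomial (in)equalities over `ℚ`. The passage
`ℝ²ⁿ → ℂⁿ` is kept abstract: any map `cv` with `re (cv x)ᵢ = xᵢ`, `im (cv x)ᵢ = x_{n+i}`.

## References

* J. Bochnak, M. Coste, M.-F. Roy, *Real Algebraic Geometry*, Ergebnisse 36, Springer (1998),
  §2.2 (Def. 2.2.5, Prop. 2.2.6).
* A. Huber, G. Wüstholz, *Transcendence and Linear Relations of 1-Periods*, Cambridge Tracts in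
  Mathematics 227, CUP (2022), §3.3.1.
* M. Kontsevich, D. Zagier, *Periods* (2001), §1.1.
-/

noncomputable section

open scoped BigOperators Topology
open Set MvPolynomial
open Literature.NumberTheory.Transcendental Literature.NumberTheory.Transcendental.CurvePeriods
open Literature.ModelTheory.ExponentialFields (IsSemialgebraic isSemialgebraic_univ
  isSemialgebraic_setOf_eval_eq_zero isSemialgebraic_setOf_eval_lt isSemialgebraic_setOf_eval_le
  tarski_seidenberg_real_holds)

namespace Summit.KontsevichZagierPeriods.SymplecticScissors.RealOnePeriodRelations

namespace SaChart

variable {n : ℕ}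

/-- Finitely many `ℚ`-semialgebraic conditions have a `ℚ`-semialgebraic conjunction.
[cite: BochnakCosteRoy1998, §2.2] -/
theorem sa_forall_fin {N : ℕ} {ι : Type*} [Fintype ι] {P : ι → (Fin N → ℝ) → Prop}
    (h : ∀ i, IsSemialgebraic ℚ {x | P i x}) :
    IsSemialgebraic ℚ {x : Fin N → ℝ | ∀ i, P i x} := by
  convert IsSemialgebraic.biInter Finset.univ (fun i => {x | P i x}) (fun i _ => h i) using 1
  ext x
  simp

/-- The diagonal condition `x a = x b` is `ℚ`-semialgebraic. [cite: BochnakCosteRoy1998, §2.2] -/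
theorem sa_coord_eq {N : ℕ} (a b : Fin N) : IsSemialgebraic ℚ {x : Fin N → ℝ | x a = x b} := by
  have hset : {x : Fin N → ℝ | x a = x b} =
      {x | aeval x (X a - X b : MvPolynomial (Fin N) ℚ) = 0} := by
    ext x
    simp [sub_eq_zero]
  rw [hset]
  exact isSemialgebraic_setOf_eval_eq_zero _

/-- The condition `q < x a`, `q ∈ ℚ`, is `ℚ`-semialgebraic. [cite: BochnakCosteRoy1998, §2.2] -/
theorem sa_const_lt {N : ℕ} (q : ℚ) (a : Fin N) :
    IsSemialgebraic ℚ {x : Fin N → ℝ | (q : ℝ) < x a} := by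
  have hset : {x : Fin N → ℝ | (q : ℝ) < x a} =
      {x | aeval x (C q : MvPolynomial (Fin N) ℚ) < aeval x (X a : MvPolynomial (Fin N) ℚ)} := by
    ext x
    simp [eq_ratCast]
  rw [hset]
  exact isSemialgebraic_setOf_eval_lt _ _

/-- The condition `x a < q`, `q ∈ ℚ`, is `ℚ`-semialgebraic. [cite: BochnakCosteRoy1998, §2.2] -/
theorem sa_lt_const {N : ℕ} (q : ℚ) (a : Fin N) :
    IsSemialgebraic ℚ {x : Fin N → ℝ | x a < q} := by
  have hset : {x : Fin N → ℝ | x a < q} =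
      {x | aeval x (X a : MvPolynomial (Fin N) ℚ) < aeval x (C q : MvPolynomial (Fin N) ℚ)} := by
    ext x
    simp [eq_ratCast]
  rw [hset]
  exact isSemialgebraic_setOf_eval_lt _ _

/-- The zero set `{x ∈ s | f x = 0}` of a `ℚ`-semialgebraic function is `ℚ`-semialgebraic (graph
elimination, Tarski–Seidenberg). [cite: BochnakCosteRoy1998, §2.2] -/
theorem sa_eq_zero {N : ℕ} {s : Set (Fin N → ℝ)} {f : (Fin N → ℝ) → ℝ}
    (hf : IsSemialgebraicFunOn ℚ s f) : IsSemialgebraic ℚ {x | x ∈ s ∧ f x = 0} := by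
  have hT : IsSemialgebraic ℚ {z : Fin (N + 1) → ℝ | z (Fin.last N) = 0} := by
    simpa using isSemialgebraic_setOf_eval_eq_zero (k := ℚ) (R := ℝ)
      (X (Fin.last N) : MvPolynomial (Fin (N + 1)) ℚ)
  convert hf.isSemialgebraic_sep_snoc_mem tarski_seidenberg_real_holds hT using 1
  ext x
  simp

/-- The closed disc `{q ∈ ℝ² | q₀ + i q₁ ∈ closedBall (c₁ + i c₂) ρ}` with rational data is
`ℚ`-semialgebraic: `(q₀ − c₁)² + (q₁ − c₂)² ≤ ρ²`. [cite: BochnakCosteRoy1998, §2.2] -/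
theorem sa_disc (c₁ c₂ ρ : ℚ) (hρ : 0 ≤ (ρ : ℝ)) :
    IsSemialgebraic ℚ
      {q : Fin 2 → ℝ | (⟨q 0, q 1⟩ : ℂ) ∈ Metric.closedBall (⟨c₁, c₂⟩ : ℂ) (ρ : ℝ)} := by
  have hset : {q : Fin 2 → ℝ | (⟨q 0, q 1⟩ : ℂ) ∈ Metric.closedBall (⟨c₁, c₂⟩ : ℂ) (ρ : ℝ)} =
      {q : Fin 2 → ℝ | aeval q ((X 0 - C c₁) ^ 2 + (X 1 - C c₂) ^ 2 : MvPolynomial (Fin 2) ℚ) ≤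
        aeval q (C (ρ ^ 2) : MvPolynomial (Fin 2) ℚ)} := by
    ext q
    simp only [mem_setOf_eq, Metric.mem_closedBall, Complex.dist_eq_re_im, map_add, map_pow,
      map_sub, aeval_X, aeval_C, eq_ratCast]
    exact Real.sqrt_le_left hρ
  rw [hset]
  exact isSemialgebraic_setOf_eval_le _ _

/-! In the sequel `cv : ℝ²ⁿ → ℂⁿ` is any map with `re (cv x)ᵢ = xᵢ` and `im (cv x)ᵢ = x_{n+i}`
(i.e. THE inverse of the realification `z ↦ Fin.append (re ∘ z) (im ∘ z)`), kept as a variable. -/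

variable {cv : (Fin (n + n) → ℝ) → (Fin n → ℂ)}

/-- `cv` is a left inverse of the realification. [folklore] -/
theorem cv_append (hre : ∀ x i, (cv x i).re = x (Fin.castAdd n i))
    (him : ∀ x i, (cv x i).im = x (Fin.natAdd n i)) (z : Fin n → ℂ) :
    cv (Fin.append (fun i => (z i).re) (fun i => (z i).im)) = z := by
  funext i
  apply Complex.ext
  · rw [hre, Fin.append_left]
  · rw [him, Fin.append_right]

/-- `cv` is a right inverse of the realification. [folklore] -/
theorem append_cv (hre : ∀ x i, (cv x i).re = x (Fin.castAdd n i))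
    (him : ∀ x i, (cv x i).im = x (Fin.natAdd n i)) (x : Fin (n + n) → ℝ) :
    Fin.append (fun i => (cv x i).re) (fun i => (cv x i).im) = x := by
  funext j
  refine Fin.addCases (fun i => ?_) (fun i => ?_) j
  · rw [Fin.append_left, hre]
  · rw [Fin.append_right, him]

/-- The coordinates `x ↦ (cv x)ᵢ` have `ℚ`-semialgebraic real and imaginary parts.
[cite: BochnakCosteRoy1998, §2.2] -/
theorem re_im_cv (hre : ∀ x i, (cv x i).re = x (Fin.castAdd n i))
    (him : ∀ x i, (cv x i).im = x (Fin.natAdd n i)) (i : Fin n) :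
    IsSemialgebraicFunOn ℚ (univ : Set (Fin (n + n) → ℝ)) (fun x => (cv x i).re) ∧
      IsSemialgebraicFunOn ℚ (univ : Set (Fin (n + n) → ℝ)) (fun x => (cv x i).im) :=
  ⟨(isSemialgebraicFunOn_aeval isSemialgebraic_univ (X (Fin.castAdd n i))).congr fun x _ => by
      simp only [aeval_X, hre],
    (isSemialgebraicFunOn_aeval isSemialgebraic_univ (X (Fin.natAdd n i))).congr fun x _ => by
      simp only [aeval_X, him]⟩

/-- **The realification of `Z(ℂ)` is `ℚ`-semialgebraic** when the equations of `Z` have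
algebraic coefficients. [cite: KontsevichZagier2001, §1.1] -/
theorem sa_cv_mem_points (Z : CurveData) {cv : (Fin (Z.n + Z.n) → ℝ) → (Fin Z.n → ℂ)}
    (hre : ∀ x i, (cv x i).re = x (Fin.castAdd Z.n i))
    (him : ∀ x i, (cv x i).im = x (Fin.natAdd Z.n i)) (hZ : ∀ j, HasAlgCoeffs (Z.F j)) :
    IsSemialgebraic ℚ {x : Fin (Z.n + Z.n) → ℝ | cv x ∈ Z.points} := by
  have h : ∀ j, IsSemialgebraic ℚ {x : Fin (Z.n + Z.n) → ℝ | eval (cv x) (Z.F j) = 0} := by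
    intro j
    have hev := HomotopyInvariance.re_im_eval (F := cv) isSemialgebraic_univ (re_im_cv hre him) (hZ j)
    have hr := sa_eq_zero hev.1
    have hi := sa_eq_zero hev.2
    convert hr.inter hi using 1
    ext x
    simp [Complex.ext_iff]
  simpa [CurveData.mem_points] using sa_forall_fin h

/-- **Rational boxes.** Every point of an open `Ω ⊆ ℂⁿ` lies in an open box
`D = {z | aᵢ < re zᵢ < bᵢ, a′ᵢ < im zᵢ < b′ᵢ}` with rational corners inside `Ω`, and the
realification of `D` is `ℚ`-semialgebraic. [cite: BochnakCosteRoy1998, §2.2] -/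
theorem exists_box (hre : ∀ x i, (cv x i).re = x (Fin.castAdd n i))
    (him : ∀ x i, (cv x i).im = x (Fin.natAdd n i)) {Ω : Set (Fin n → ℂ)} (hΩ : IsOpen Ω)
    {z₀ : Fin n → ℂ} (hz₀ : z₀ ∈ Ω) :
    ∃ D : Set (Fin n → ℂ), IsOpen D ∧ z₀ ∈ D ∧ D ⊆ Ω ∧
      IsSemialgebraic ℚ {x : Fin (n + n) → ℝ | cv x ∈ D} := by
  obtain ⟨r, hr, hball⟩ := Metric.isOpen_iff.mp hΩ z₀ hz₀
  have ha : ∀ i : Fin n, ∃ q : ℚ, (z₀ i).re - r / 2 < q ∧ (q : ℝ) < (z₀ i).re :=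
    fun i => exists_rat_btwn (by linarith)
  have hb : ∀ i : Fin n, ∃ q : ℚ, (z₀ i).re < q ∧ (q : ℝ) < (z₀ i).re + r / 2 :=
    fun i => exists_rat_btwn (by linarith)
  have ha' : ∀ i : Fin n, ∃ q : ℚ, (z₀ i).im - r / 2 < q ∧ (q : ℝ) < (z₀ i).im :=
    fun i => exists_rat_btwn (by linarith)
  have hb' : ∀ i : Fin n, ∃ q : ℚ, (z₀ i).im < q ∧ (q : ℝ) < (z₀ i).im + r / 2 :=
    fun i => exists_rat_btwn (by linarith)
  choose a ha₁ ha₂ using ha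
  choose b hb₁ hb₂ using hb
  choose a' ha'₁ ha'₂ using ha'
  choose b' hb'₁ hb'₂ using hb'
  refine ⟨{z | ∀ i, (a i : ℝ) < (z i).re ∧ (z i).re < b i ∧ (a' i : ℝ) < (z i).im ∧
      (z i).im < b' i}, ?_, fun i => ⟨ha₂ i, hb₁ i, ha'₂ i, hb'₁ i⟩, fun z hz => hball ?_, ?_⟩
  · -- open
    simp only [setOf_forall]
    refine isOpen_iInter_of_finite fun i => ?_
    have hcr : Continuous fun z : Fin n → ℂ => (z i).re :=
      Complex.continuous_re.comp (continuous_apply i)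
    have hci : Continuous fun z : Fin n → ℂ => (z i).im :=
      Complex.continuous_im.comp (continuous_apply i)
    exact (isOpen_lt continuous_const hcr).inter ((isOpen_lt hcr continuous_const).inter
      ((isOpen_lt continuous_const hci).inter (isOpen_lt hci continuous_const)))
  · -- inside the ball `B(z₀, r) ⊆ Ω`
    rw [Metric.mem_ball, dist_pi_lt_iff hr]
    intro i
    obtain ⟨h₁, h₂, h₃, h₄⟩ := hz i
    rw [Complex.dist_eq]
    refine (Complex.norm_le_abs_re_add_abs_im _).trans_lt ?_
    have e₁ : |(z i - z₀ i).re| < r / 2 := by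
      rw [Complex.sub_re, abs_sub_lt_iff]
      constructor <;> linarith [ha₁ i, hb₂ i]
    have e₂ : |(z i - z₀ i).im| < r / 2 := by
      rw [Complex.sub_im, abs_sub_lt_iff]
      constructor <;> linarith [ha'₁ i, hb'₂ i]
    linarith
  · -- semialgebraic realification
    simp only [mem_setOf_eq, hre, him]
    exact sa_forall_fin fun i => (sa_const_lt (a i) _).inter ((sa_lt_const (b i) _).inter
      ((sa_const_lt (a' i) _).inter (sa_lt_const (b' i) _)))

/-- Every complex number has a Gaussian rational at distance `< r`, `r > 0`. [folklore] -/
theorem exists_gaussRat_near (w : ℂ) {r : ℝ} (hr : 0 < r) :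
    ∃ c₁ c₂ : ℚ, dist w (⟨c₁, c₂⟩ : ℂ) < r := by
  obtain ⟨c₁, h₁, h₁'⟩ := exists_rat_btwn (show w.re - r / 2 < w.re by linarith)
  obtain ⟨c₂, h₂, h₂'⟩ := exists_rat_btwn (show w.im - r / 2 < w.im by linarith)
  refine ⟨c₁, c₂, ?_⟩
  rw [Complex.dist_eq]
  refine (Complex.norm_le_abs_re_add_abs_im _).trans_lt ?_
  have e₁ : |(w - ⟨c₁, c₂⟩).re| < r / 2 := by
    rw [Complex.sub_re, abs_sub_lt_iff]
    constructor <;> simp <;> linarith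
  have e₂ : |(w - ⟨c₁, c₂⟩).im| < r / 2 := by
    rw [Complex.sub_im, abs_sub_lt_iff]
    constructor <;> simp <;> linarith
  linarith

/-- **Semialgebraic graphs.** If on the closed disc `closedBall c ρ` (Gaussian-rational centre,
rational radius) the map `ψ` takes values in `P ∩ D` with `ψ(w) i₀ = w`, and conversely every
`z ∈ P ∩ D` with `z i₀` in the disc is `ψ(z i₀)`, where the realifications of `P`, `D ⊆ ℂⁿ` are
`ℚ`-semialgebraic, then the realified `ψ` is a `ℚ`-semialgebraic map on the disc: its graph is
`{(w, z) | w ∈ closedBall c ρ, z ∈ P, z ∈ D, z i₀ = w}`. [cite: BochnakCosteRoy1998, Def. 2.2.5] -/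
theorem isSemialgebraicMapOn_of_graph (hre : ∀ x i, (cv x i).re = x (Fin.castAdd n i))
    (him : ∀ x i, (cv x i).im = x (Fin.natAdd n i)) {P D : Set (Fin n → ℂ)}
    (hP : IsSemialgebraic ℚ {x : Fin (n + n) → ℝ | cv x ∈ P})
    (hD : IsSemialgebraic ℚ {x : Fin (n + n) → ℝ | cv x ∈ D}) (i₀ : Fin n) {c₁ c₂ ρ : ℚ}
    (hρ : 0 ≤ (ρ : ℝ)) {ψ : ℂ → (Fin n → ℂ)}
    (h1 : ∀ w ∈ Metric.closedBall (⟨c₁, c₂⟩ : ℂ) (ρ : ℝ), ψ w ∈ P ∧ ψ w ∈ D ∧ ψ w i₀ = w)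
    (h2 : ∀ z ∈ P, z ∈ D → z i₀ ∈ Metric.closedBall (⟨c₁, c₂⟩ : ℂ) (ρ : ℝ) → ψ (z i₀) = z) :
    IsSemialgebraicMapOn ℚ
      {q : Fin 2 → ℝ | (⟨q 0, q 1⟩ : ℂ) ∈ Metric.closedBall (⟨c₁, c₂⟩ : ℂ) (ρ : ℝ)}
      (fun q => Fin.append (fun i => (ψ ⟨q 0, q 1⟩ i).re) (fun i => (ψ ⟨q 0, q 1⟩ i).im)) := by
  rw [isSemialgebraicMapOn_iff]
  have hS := (sa_disc c₁ c₂ ρ hρ).preimage_comp (Fin.castAdd (n + n))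
  have hPD := (hP.inter hD).preimage_comp (Fin.natAdd 2)
  have hE : IsSemialgebraic ℚ {z : Fin (2 + (n + n)) → ℝ |
      z (Fin.natAdd 2 (Fin.castAdd n i₀)) = z (Fin.castAdd (n + n) 0) ∧
        z (Fin.natAdd 2 (Fin.natAdd n i₀)) = z (Fin.castAdd (n + n) 1)} :=
    (sa_coord_eq _ _).inter (sa_coord_eq _ _)
  convert (hS.inter hPD).inter hE using 1
  ext z
  simp only [mem_setOf_eq, mem_inter_iff, mem_preimage, Function.comp_def]
  constructor
  · rintro ⟨hq, hx⟩
    obtain ⟨hwP, hwD, hwi⟩ := h1 _ hq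
    have hc : cv (fun j => z (Fin.natAdd 2 j)) =
        ψ ⟨z (Fin.castAdd (n + n) 0), z (Fin.castAdd (n + n) 1)⟩ := by
      rw [hx, cv_append hre him]
    have hci : cv (fun j => z (Fin.natAdd 2 j)) i₀ =
        ⟨z (Fin.castAdd (n + n) 0), z (Fin.castAdd (n + n) 1)⟩ := by
      rw [hc]
      exact hwi
    have h' := Complex.ext_iff.mp hci
    exact ⟨⟨hq, hc ▸ hwP, hc ▸ hwD⟩, (hre _ _).symm.trans h'.1, (him _ _).symm.trans h'.2⟩
  · rintro ⟨⟨hq, hxP, hxD⟩, he₁, he₂⟩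
    refine ⟨hq, ?_⟩
    have hci : cv (fun j => z (Fin.natAdd 2 j)) i₀ =
        ⟨z (Fin.castAdd (n + n) 0), z (Fin.castAdd (n + n) 1)⟩ :=
      Complex.ext ((hre _ _).trans he₁) ((him _ _).trans he₂)
    have hψ := h2 _ hxP hxD (by rw [hci]; exact hq)
    rw [hci] at hψ
    rw [hψ, append_cv hre him]

end SaChart

/-- **Semialgebraic graph charts** (registered stub `stub_saChart` of crux
stmt-KontsevichZagierPeriods-10042, line `nash-retraction-thin-strip`). At every point `z₀` of a
smooth affine curve `Z` over `ℚ̄` there is a holomorphic graph chart `ψ` over a coordinate `i₀`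
as delivered by `CurveData.IsSmoothAffineCurve.exists_localChart`, re-centred at a
Gaussian-rational point `c` with `z₀ i₀ ∈ ball c (ρ/6)`, `0 < ρ < ε`, `ρ` rational, which is a
`ℚ`-SEMIALGEBRAIC map on the closed disc `closedBall c ρ` after realification `ℂ = ℝ²`,
`ℂⁿ = ℝ²ⁿ`: its graph there is `{(w, z) | z ∈ Z(ℂ) ∩ D, z i₀ = w}` for a rational box `D` inside
the chart neighbourhood, and `Z(ℂ) ⊂ ℝ²ⁿ` is `ℚ`-semialgebraic (equations with algebraic
coefficients). [cite: BochnakCosteRoy1998, §2.2] -/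
theorem stub_saChart : ∀ (Z : CurveData), Z.IsSmoothAffineCurve → ∀ z₀ ∈ Z.points,
    ∃ (i₀ : Fin Z.n) (c : ℂ) (ε ρ : ℝ) (Ω : Set (Fin Z.n → ℂ)) (ψ : ℂ → (Fin Z.n → ℂ)),
      0 < ρ ∧ ρ < ε ∧ IsOpen Ω ∧ z₀ ∈ Ω ∧ z₀ i₀ ∈ Metric.ball c (ρ / 6) ∧ AnalyticOnNhd ℂ ψ (Metric.ball c ε) ∧
      (∀ z ∈ Ω, z ∈ Z.points → z i₀ ∈ Metric.ball c ε ∧ ψ (z i₀) = z) ∧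
      (∀ w ∈ Metric.ball c ε, ψ w ∈ Ω ∧ ψ w ∈ Z.points ∧ ψ w i₀ = w) ∧
      IsSemialgebraicMapOn ℚ {q : Fin 2 → ℝ | (⟨q 0, q 1⟩ : ℂ) ∈ Metric.closedBall c ρ}
        (fun q => Fin.append (fun i => (ψ ⟨q 0, q 1⟩ i).re) (fun i => (ψ ⟨q 0, q 1⟩ i).im)) := by
  intro Z hZ z₀ hz₀
  obtain ⟨i₀, ε₀, Ω₀, ψ, hε₀, hΩ₀, hz₀Ω₀, hψ, h1, h2⟩ := hZ.exists_localChart hz₀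
  -- the passage `ℝ²ⁿ → ℂⁿ`
  set cv : (Fin (Z.n + Z.n) → ℝ) → (Fin Z.n → ℂ) :=
    fun x i => ⟨x (Fin.castAdd Z.n i), x (Fin.natAdd Z.n i)⟩ with hcv
  have hre : ∀ x i, (cv x i).re = x (Fin.castAdd Z.n i) := fun _ _ => rfl
  have him : ∀ x i, (cv x i).im = x (Fin.natAdd Z.n i) := fun _ _ => rfl
  -- a rational box `D` around `z₀` inside `Ω₀`
  obtain ⟨D, hDo, hz₀D, hDΩ, hDsa⟩ := SaChart.exists_box hre him hΩ₀ hz₀Ω₀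
  -- `ψ (z₀ i₀) = z₀`, and `ψ` maps a small disc into the box
  have hψz₀ : ψ (z₀ i₀) = z₀ := (h1 z₀ hz₀Ω₀ hz₀).2
  have hcont : ContinuousAt ψ (z₀ i₀) := (hψ (z₀ i₀) (Metric.mem_ball_self hε₀)).continuousAt
  have hDn : D ∈ 𝓝 (ψ (z₀ i₀)) := by
    rw [hψz₀]
    exact hDo.mem_nhds hz₀D
  obtain ⟨δ₁, hδ₁, hballδ₁⟩ := Metric.mem_nhds_iff.mp (hcont.preimage_mem_nhds hDn)
  -- radii: `0 < ρ < δ / 4`, `δ = min δ₁ ε₀`, `ρ` rational; centre `c` Gaussian-rational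
  obtain ⟨ρ, hρ0, hρδ⟩ := exists_rat_btwn (show (0 : ℝ) < min δ₁ ε₀ / 4 by positivity)
  have hδ₁' : min δ₁ ε₀ ≤ δ₁ := min_le_left _ _
  have hε₀' : min δ₁ ε₀ ≤ ε₀ := min_le_right _ _
  obtain ⟨c₁, c₂, hc⟩ := SaChart.exists_gaussRat_near (z₀ i₀) (show (0 : ℝ) < ρ / 6 by positivity)
  -- the disc `ball c (2ρ)` lies in the tree's disc, the closed disc `closedBall c ρ` in `ball _ δ₁`
  have hsub : ∀ w, dist w (⟨c₁, c₂⟩ : ℂ) < 2 * ρ → dist w (z₀ i₀) < ε₀ := fun w hw => by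
    have := dist_triangle w (⟨c₁, c₂⟩ : ℂ) (z₀ i₀)
    rw [dist_comm (⟨c₁, c₂⟩ : ℂ)] at this
    linarith
  have hsub' : ∀ w, dist w (⟨c₁, c₂⟩ : ℂ) ≤ ρ → dist w (z₀ i₀) < δ₁ ∧ dist w (z₀ i₀) < ε₀ :=
    fun w hw => by
    have := dist_triangle w (⟨c₁, c₂⟩ : ℂ) (z₀ i₀)
    rw [dist_comm (⟨c₁, c₂⟩ : ℂ)] at this
    constructor <;> linarith
  refine ⟨i₀, ⟨c₁, c₂⟩, 2 * ρ, ρ, Ω₀ ∩ (fun z => z i₀) ⁻¹' Metric.ball (⟨c₁, c₂⟩ : ℂ) (2 * ρ), ψ,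
    hρ0, by linarith, hΩ₀.inter (Metric.isOpen_ball.preimage (continuous_apply i₀)),
    ⟨hz₀Ω₀, ?_⟩, hc, hψ.mono fun w hw => hsub w hw, fun z hz hzZ => ⟨hz.2, (h1 z hz.1 hzZ).2⟩,
    fun w hw => ?_, ?_⟩
  · show dist (z₀ i₀) (⟨c₁, c₂⟩ : ℂ) < 2 * ρ
    have : dist (z₀ i₀) (⟨c₁, c₂⟩ : ℂ) < ρ / 6 := hc
    linarith
  · obtain ⟨hΩ, hZ', hi⟩ := h2 w (hsub w hw)
    refine ⟨⟨hΩ, ?_⟩, hZ', hi⟩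
    show ψ w i₀ ∈ Metric.ball (⟨c₁, c₂⟩ : ℂ) (2 * ρ)
    rw [hi]
    exact hw
  · refine SaChart.isSemialgebraicMapOn_of_graph hre him
      (SaChart.sa_cv_mem_points Z hre him hZ.algebraic) hDsa i₀ hρ0.le (fun w hw => ?_)
      (fun z hzZ hzD _ => ?_)
    · obtain ⟨hwδ₁, hwε₀⟩ := hsub' w hw
      obtain ⟨_, hZ', hi⟩ := h2 w hwε₀
      exact ⟨hZ', hballδ₁ hwδ₁, hi⟩
    · exact (h1 z (hDΩ hzD) hzZ).2

end Summit.KontsevichZagierPeriods.SymplecticScissors.RealOnePeriodRelations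

end
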